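import Summits.BirchSwinnertonDyer.BirchSwinnertonDyer.Theorems.PrintCf2RamifiedOffTYZRankZeroDigitDepthTwo
import Summits.BirchSwinnertonDyer.BirchSwinnertonDyer.Theorems.PrintCf2RamifiedOffTYZInvisibleGenerator
import HarnessLib

/-!
# C⁺ on the invisible stratum of R2 IS «the genus PERIOD `Z(lq)` has depth exactly one» — corrected by the prime's class `α_q` exactly on the rows
# where the rank-zero factor `E_l` has `Ш[4] = Ш[2]` (crux stmt-BirchSwinnertonDyer-20509 `RamifiedOffTYZOfFacts`, line `offtyz-v7`, LEAD g25, cycle 26)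

HONEST FRAMING (cell `bsd-print-cf2`, route `PrintCf2`; `--supports stmt-BirchSwinnertonDyer-20509`; `def`-free, no `sorry`).  BSD is not proved by
any of this; no class is closed by this file; item 23431 (C⁺) and crux 20509 stay OPEN.

The composition of this seat's depth-two dichotomy (`…RankZeroDigitDepthTwo`) with g18's structure theorem on the invisible special stratum
(`InvisibleGenerator.levelTwo_iff_depth_genusPoint_eq_one_of_X_eq_two_mul_sq`: «C⁺ at `n` ⟺ `P(n) ∈ 2A + tors ∧ P(n) ∉ 4A + tors`»).  Sector R2 of the
census: `n = lq`, `l ≡ 1`, `q ≡ 7 (mod 8)` primes (block-free, `n ≡ 7`), `ord_{s=1} L(E_n, s) = 1`, `ρ(n) = 0`, the `A_n`-generator of the invisible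
shape `h = (2s², Y)` (`d(h) = 2`).  Inputs: GZK (conjunct 1), modularity (conjunct 2), CM rank-zero BSD (conjunct 4); the display package of `n` with its
CM-point layer; Thm 3.5 at the prime `q` read in `ℍ′_n` (`h35q`, `u = ±1`, `𝓛(q)` odd) — exactly g10's/g18's interface.

* §1 `twoDivisible_genusPoint_iff_genusPeriod` — at LAYER ONE the genus point and the genus period of `lq` always agree: `P(lq) ∈ 2A + tors ⟺
  Z(lq) ∈ 2A + tors` (whatever the parity of `𝓛(l)/2`, because `α_q ∈ 2A + tors`).
* §2 ★★★ `levelTwo_iff_genusPeriod_depth_dichotomy_of_facts` — granted conjuncts 1, 2, 4 of 𝔅_ram, on the invisible R2 stratum with `r_an(E_l) = 0`: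
  **if `#Sel₄(E_l) ≠ 2⁴`:  C⁺ at `lq` ⟺ `Z(lq) ∈ 2A + tors ∧ Z(lq) ∉ 4A + tors`** (the genus PERIOD has depth exactly one);
  **if `#Sel₄(E_l) = 2⁴`:  C⁺ at `lq` ⟺ `Z(lq) ∈ 2A + tors ∧ Z(lq) − α_q ∉ 4A + tors`**;
  `levelTwo_iff_genusPeriod_depth_of_two_le_analyticRank` — with `r_an(E_l) ≥ 2` (`𝓛(l) = 0`, `P = Z`): C⁺ ⟺ `Z ∈ 2A + tors ∧ Z ∉ 4A + tors`.
* §3 ★★★ `levelTwo_iff_genusPeriod_depth_dichotomy_of_wang` — the same dichotomy read on `l` itself (Wang 2016 Thm 3 + Lemma 4): `l = x² + 32y²`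
  (`¬ IsDeltaOne l`) vs `l = u² + 8v²`, `v` odd (`IsDeltaOne l`).

So on these rows the census B-law «B ⟹ l = x² + 32y²» reads: B (`4 ∣ 𝓛(lq)`) ⟺ `Z(lq) ∈ 4A + tors` on the `l = x² + 32y²` rows, ⟺ `Z(lq) ≡ α_q (mod 4A + tors)`
on the others — and the census (0 B-rows with `l ≠ x² + 32y²`, g17 §11) says the second congruence never occurs: the sharpened beyond-print target on
invisible R2 is the pair of genus-PERIOD laws «`Z(lq) ≢ α_q (mod 4A + tors)`» (all rows) and «`Z(lq) ∈ 4A + tors ⟺ (q/l)₄ = 1 ∧ …`» (`l = x² + 32y²` rows).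

References: [cite: TianYuanZhang2017, §3.1 (p0011 L67–L73), Thm. 3.5 (p0011 L94–L100), Lemma 3.18, §1 (1.1)]; [cite: BurungaleFlach2024, Thm 1.1 / Cor. 3];
[cite: Wang2016CongruentSha, Thm. 3 and Lemma 4]; [cite: Darmon2004, Thm. 3.22]; [cite: SilvermanAEC2009, Prop. X.1.4, X.4.9]; tree: `…InvisibleGenerator`,
`…LevelTwoTwoPrimes`, `…RankZeroDigit{,Wang,DepthTwo}`.  LEAD memo: `Lines/offtyz_v7_RankZeroDigit.md`.
-/

noncomputable section

open scoped Classical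

open WeierstrassCurve WeierstrassCurve.Affine WeierstrassCurve.Affine.Point
  Literature.NumberTheory.EllipticCurves Literature.NumberTheory.EllipticCurves.Rank1Residual
  Summit.BirchSwinnertonDyer.Rank1Residual
  Literature.NumberTheory.EllipticCurves.TianYuanZhang2017
  Literature.NumberTheory.EllipticCurves.TianYuanZhang2017.W2
  Literature.NumberTheory.EllipticCurves.Wang2016
  Summit.BirchSwinnertonDyer.Rank1Residual.P2.ThetaDescent
  Summit.BirchSwinnertonDyer.PrintCf2.LevelTwoTwoPrimes

set_option autoImplicit false

namespace Summit.BirchSwinnertonDyer.PrintCf2.RankZeroDigitDepthTwo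

/-! ## §1 Layer one: `[P(lm)] = [Z(lm)]` regardless of the parity of `𝓛(l)/2` -/

section LayerOne

variable {G : Type*} [AddCommGroup G]

/-- `a ∈ 2G + tors` ⟹ (`z − a ∈ 2G + tors ⟺ z ∈ 2G + tors`). [folklore] -/
theorem twoDivisible_sub_iff_of_twoDivisible {z a : G} (ha : ∃ b : G, IsOfFinAddOrder (a - (2 : ℤ) • b)) :
    (∃ y : G, IsOfFinAddOrder (z - a - (2 : ℤ) • y)) ↔ ∃ y : G, IsOfFinAddOrder (z - (2 : ℤ) • y) := by
  obtain ⟨b, hb⟩ := ha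
  constructor
  · rintro ⟨y, hy⟩
    refine ⟨y + b, ?_⟩
    have e : z - (2 : ℤ) • (y + b) = (z - a - (2 : ℤ) • y) + (a - (2 : ℤ) • b) := by module
    rw [e]
    exact hy.add hb
  · rintro ⟨y, hy⟩
    refine ⟨y - b, ?_⟩
    have e : z - a - (2 : ℤ) • (y - b) = (z - (2 : ℤ) • y) + -(a - (2 : ℤ) • b) := by module
    rw [e]
    exact hy.add hb.neg

variable {n : ℕ}

/-- **Layer one on the two-prime sector: `P(lm) ∈ 2A + tors ⟺ Z(lm) ∈ 2A + tors`**, for `𝓛(l)` EVEN of either parity of `𝓛(l)/2` (data with the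
displayed recursion and `ε`-types; Thm 3.5 at `m` with `u = ±1`, `𝓛(m)` odd, whence `α_m ∈ 2A + tors`).
[cite: TianYuanZhang2017, §3.1 (p0011 L67–L73), Thm. 3.5 (p0011 L94–L100)] -/
theorem twoDivisible_genusPoint_iff_genusPeriod {l m : ℕ} (hl : l.Prime) (hm : m.Prime) (hl8 : l % 8 = 1)
    (hm8 : m % 8 = 5 ∨ m % 8 = 7) (hn : n = l * m) (D : GenusPointData n) (hrec : D.recursion) (heps : D.epsSpec)
    (h2 : (2 : ℤ) ∣ D.scriptL l) (hLm : Odd (D.scriptL m)) {αm : APoint D.H} {u : ℤ} (hu : u = 1 ∨ u = -1)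
    (h35m : IsOfFinAddOrder ((2 : ℤ) • D.P m - (u * D.scriptL m) • αm)) :
    (∃ y : APoint D.H, IsOfFinAddOrder (D.P n - (2 : ℤ) • y)) ↔ ∃ y : APoint D.H, IsOfFinAddOrder (D.Z n - (2 : ℤ) • y) := by
  obtain ⟨c', hc'⟩ := h2
  obtain ⟨s, hs, h⟩ := genusPoint_two_primes_congr hl hm hl8 hm8 hn D hrec heps (c' := c') (by rw [hc']) h35m
  rcases Int.even_or_odd c' with hev | hodd
  · exact twoDivisible_iff_of_even (by obtain ⟨j, rfl⟩ := hev; exact ⟨s * j * (u * D.scriptL m), by ring⟩) h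
  · rw [twoDivisible_iff_of_odd ((odd_coeff_iff hs hu hLm).mpr hodd) h]
    exact twoDivisible_sub_iff_of_twoDivisible (twoDivisible_of_h35m D hu hLm h35m)

end LayerOne

/-! ## §2 C⁺ on the invisible R2 stratum, by the rank-zero digit of `E_l` -/

section Invisible

variable {n : ℕ}

/-- `lq` is square-free and `≡ 7 (mod 8)` with no divisor `≡ 5 (mod 8)`, for primes `l ≡ 1`, `q ≡ 7 (mod 8)`. [folklore] -/
theorem sector_R2 {l q : ℕ} (hl : l.Prime) (hq : q.Prime) (hl8 : l % 8 = 1) (hq8 : q % 8 = 7) (hn : n = l * q) :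
    Squarefree n ∧ n % 8 = 7 ∧ ∀ d ∈ n.divisors, d % 8 ≠ 5 := by
  subst hn
  have hne : l ≠ q := fun h => by subst h; omega
  refine ⟨?_, by rw [mul_mod_eight_of_one hl8, hq8], fun d hd => ?_⟩
  · rw [Nat.squarefree_mul_iff]
    exact ⟨(Nat.coprime_primes hl hq).mpr hne, hl.squarefree, hq.squarefree⟩
  · rcases (Summit.BirchSwinnertonDyer.Rank1Residual.P2.ThetaDescent.dvd_prime_mul_prime_iff hl hq).mp (Nat.dvd_of_mem_divisors hd) with rfl | rfl | rfl | rfl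
    · omega
    · omega
    · omega
    · rw [mul_mod_eight_of_one hl8]; omega

/-- ★★★ **C⁺ ON THE INVISIBLE R2 STRATUM IS A DEPTH STATEMENT ABOUT THE GENUS PERIOD, SPLIT BY `#Sel₄(E_l)`.**  Granted GZK, modularity and CM
rank-zero BSD (conjuncts 1, 2, 4 of 𝔅_ram): primes `l ≡ 1`, `q ≡ 7 (mod 8)`, `n = lq` with `ord_{s=1} L(E_n, s) = 1` and `ord_{s=1} L(E_l, s) = 0`; data
`D` with `Printed` and the CM-point layer; `ρ(n) = 0`; the `A_n`-generator of shape `(2s², Y)`; Thm 3.5 at `q` in `ℍ′_n` (`h35q`, `u = ±1`, `𝓛(q)` odd).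
Then:  if `#Sel₄(E_l) ≠ 2⁴`, the conclusion of C⁺ at `n` holds **iff `Z(lq) ∈ 2A(ℍ′_n) + tors` and `Z(lq) ∉ 4A(ℍ′_n) + tors`**;  if `#Sel₄(E_l) = 2⁴`, it
holds **iff `Z(lq) ∈ 2A(ℍ′_n) + tors` and `Z(lq) − α_q ∉ 4A(ℍ′_n) + tors`**.
[cite: TianYuanZhang2017, §3.1, Thm. 3.5, Lemma 3.18, §1 (1.1)] [cite: BurungaleFlach2024, Thm 1.1 / Cor. 3] [cite: Darmon2004, Thm. 3.22]
[cite: SilvermanAEC2009, Prop. X.1.4, X.4.9] -/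
theorem levelTwo_iff_genusPeriod_depth_dichotomy_of_facts (hGZK : rank_eq_analyticRank_of_analyticRank_le_one)
    (hmod : WeierstrassCurve.hasEntireLFunction_rat) (hCM0 : bsdTriple_of_hasCM_of_L_one_ne_zero)
    {l q : ℕ} (hl : l.Prime) (hq : q.Prime) (hl8 : l % 8 = 1) (hq8 : q % 8 = 7) (hn : n = l * q)
    (hr : (congruentNumberCurve n).analyticRank = 1) (h0 : (congruentNumberCurve l).analyticRank = 0)
    (D : GenusPointData n) (hPr : D.Printed) (hC : D.CMPointCompositumPrinted) (hρ : (rhoSubgroup n).index = 1)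
    {X Y : ℚ} (h : (Atwo n).toAffine.Nonsingular X Y) {s : ℚ} (hs : s ≠ 0) (hX : X = 2 * s ^ 2)
    (hgen : ∀ P : (Atwo n).toAffine.Point, ∃ m : ℤ, IsOfFinAddOrder (P - m • (Point.some X Y h : (Atwo n).toAffine.Point)))
    (hLq : Odd (D.scriptL q)) {αq : APoint D.H} {u : ℤ} (hu : u = 1 ∨ u = -1)
    (h35q : IsOfFinAddOrder ((2 : ℤ) • D.P q - (u * D.scriptL q) • αq)) :
    (Nat.card ((congruentNumberCurve l).selmerGroup 4) ≠ 2 ^ 4 →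
      ((∀ L : ℤ, IsScriptL n L → (2 : ℤ) ∣ L ∧ ¬ (4 : ℤ) ∣ L) ↔
        ((∃ y : APoint D.H, IsOfFinAddOrder (D.Z n - (2 : ℤ) • y)) ∧
          ¬ ∃ y : APoint D.H, IsOfFinAddOrder (D.Z n - (4 : ℤ) • y)))) ∧
    (Nat.card ((congruentNumberCurve l).selmerGroup 4) = 2 ^ 4 →
      ((∀ L : ℤ, IsScriptL n L → (2 : ℤ) ∣ L ∧ ¬ (4 : ℤ) ∣ L) ↔
        ((∃ y : APoint D.H, IsOfFinAddOrder (D.Z n - (2 : ℤ) • y)) ∧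
          ¬ ∃ y : APoint D.H, IsOfFinAddOrder (D.Z n - αq - (4 : ℤ) • y)))) := by
  obtain ⟨hsq, h7, hnb⟩ := sector_R2 hl hq hl8 hq8 hn
  have hq8' : q % 8 = 5 ∨ q % 8 = 7 := Or.inr hq8
  have hLs : D.scriptLSpec := hPr.1
  have heps : D.epsSpec := hPr.2.1
  have hrec : D.recursion := hPr.2.2.1
  -- g18: C⁺ at `n` ⟺ `P ∈ 2A + tors ∧ P ∉ 4A + tors`
  have hP := InvisibleGenerator.levelTwo_iff_depth_genusPoint_eq_one_of_X_eq_two_mul_sq hGZK hsq h7 hnb hr D hPr hC hρ h hs hX hgen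
  -- the digit of `E_l`
  obtain ⟨-, h2, -⟩ := RankZeroDigit.prime_one_mod_eight_digit_of_facts hmod hCM0 hl hl8 h0 (isScriptL_scriptL_left hl hq hn D hLs)
  have h1 := twoDivisible_genusPoint_iff_genusPeriod hl hq hl8 hq8' hn D hrec heps h2 hLq hu h35q
  obtain ⟨hne, heq⟩ := fourDivisible_genusPoint_dichotomy_of_facts hmod hCM0 hl hq hl8 hq8' hn h0 D hLs hrec heps hLq hu h35q
  constructor
  · intro hS₄
    rw [hP, h1, hne hS₄]
  · intro hS₄
    rw [hP, h1, heq hS₄]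

/-- **The `r_an(E_l) ≥ 2` rows** (the prime `l` congruent, `𝓛(l) = 0`, `P(lq) = Z(lq)`): granted GZK, on the same stratum the conclusion of C⁺ at `n`
holds **iff `Z(lq) ∈ 2A + tors` and `Z(lq) ∉ 4A + tors`**. [cite: TianYuanZhang2017, §3.1, Thm. 3.5, §1] [cite: Darmon2004, Thm. 3.22] -/
theorem levelTwo_iff_genusPeriod_depth_of_two_le_analyticRank (hGZK : rank_eq_analyticRank_of_analyticRank_le_one)
    {l q : ℕ} (hl : l.Prime) (hq : q.Prime) (hl8 : l % 8 = 1) (hq8 : q % 8 = 7) (hn : n = l * q)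
    (hr : (congruentNumberCurve n).analyticRank = 1) (hl2 : 2 ≤ (congruentNumberCurve l).analyticRank)
    (D : GenusPointData n) (hPr : D.Printed) (hC : D.CMPointCompositumPrinted) (hρ : (rhoSubgroup n).index = 1)
    {X Y : ℚ} (h : (Atwo n).toAffine.Nonsingular X Y) {s : ℚ} (hs : s ≠ 0) (hX : X = 2 * s ^ 2)
    (hgen : ∀ P : (Atwo n).toAffine.Point, ∃ m : ℤ, IsOfFinAddOrder (P - m • (Point.some X Y h : (Atwo n).toAffine.Point))) :
    (∀ L : ℤ, IsScriptL n L → (2 : ℤ) ∣ L ∧ ¬ (4 : ℤ) ∣ L) ↔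
      ((∃ y : APoint D.H, IsOfFinAddOrder (D.Z n - (2 : ℤ) • y)) ∧
        ¬ ∃ y : APoint D.H, IsOfFinAddOrder (D.Z n - (4 : ℤ) • y)) := by
  obtain ⟨hsq, h7, hnb⟩ := sector_R2 hl hq hl8 hq8 hn
  have hPZ : D.P n = D.Z n :=
    genusPoint_eq_genusPeriod_of_two_le_analyticRank hl hq hl8 (Or.inr hq8) hn hl2 D hPr.1 hPr.2.2.1 hPr.2.1
  rw [InvisibleGenerator.levelTwo_iff_depth_genusPoint_eq_one_of_X_eq_two_mul_sq hGZK hsq h7 hnb hr D hPr hC hρ h hs hX hgen, hPZ]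

end Invisible

/-! ## §3 The same dichotomy read on `l`: `x² + 32y²` versus `u² + 8v²` (`v` odd) -/

section Wang

variable {n : ℕ}

/-- ★★★ **C⁺ ON THE INVISIBLE R2 STRATUM, SPLIT BY THE SHAPE OF `l`.**  Granted conjuncts 1, 2, 4 of 𝔅_ram and Wang 2016 Thm 3 + Lemma 4, on the
stratum of `levelTwo_iff_genusPeriod_depth_dichotomy_of_facts` (with `r_an(E_l) = 0`):  if `l` is NOT of the form `u² + 8v²` with `v` odd (for a prime
`l ≡ 1 (mod 8)`: `l = x² + 32y²`), C⁺ at `lq` ⟺ `Z(lq) ∈ 2A + tors ∧ Z(lq) ∉ 4A + tors`;  if `l = u² + 8v²` with `v` odd, C⁺ at `lq` ⟺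
`Z(lq) ∈ 2A + tors ∧ Z(lq) − α_q ∉ 4A + tors`. [cite: Wang2016CongruentSha, Thm. 3 and Lemma 4] [cite: TianYuanZhang2017, §3.1, Thm. 3.5]
[cite: BurungaleFlach2024, Thm 1.1 / Cor. 3] [cite: Darmon2004, Thm. 3.22] -/
theorem levelTwo_iff_genusPeriod_depth_dichotomy_of_wang (hGZK : rank_eq_analyticRank_of_analyticRank_le_one)
    (hmod : WeierstrassCurve.hasEntireLFunction_rat) (hCM0 : bsdTriple_of_hasCM_of_L_one_ne_zero)
    (h3 : thm3_rank_zero_and_sha_two_by_two) (hL4 : lem4_card_selmerGroup_two_eq_sixteen_iff_h4)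
    {l q : ℕ} (hl : l.Prime) (hq : q.Prime) (hl8 : l % 8 = 1) (hq8 : q % 8 = 7) (hn : n = l * q)
    (hr : (congruentNumberCurve n).analyticRank = 1) (h0 : (congruentNumberCurve l).analyticRank = 0)
    (D : GenusPointData n) (hPr : D.Printed) (hC : D.CMPointCompositumPrinted) (hρ : (rhoSubgroup n).index = 1)
    {X Y : ℚ} (h : (Atwo n).toAffine.Nonsingular X Y) {s : ℚ} (hs : s ≠ 0) (hX : X = 2 * s ^ 2)
    (hgen : ∀ P : (Atwo n).toAffine.Point, ∃ m : ℤ, IsOfFinAddOrder (P - m • (Point.some X Y h : (Atwo n).toAffine.Point)))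
    (hLq : Odd (D.scriptL q)) {αq : APoint D.H} {u : ℤ} (hu : u = 1 ∨ u = -1)
    (h35q : IsOfFinAddOrder ((2 : ℤ) • D.P q - (u * D.scriptL q) • αq)) :
    (¬ IsDeltaOne l →
      ((∀ L : ℤ, IsScriptL n L → (2 : ℤ) ∣ L ∧ ¬ (4 : ℤ) ∣ L) ↔
        ((∃ y : APoint D.H, IsOfFinAddOrder (D.Z n - (2 : ℤ) • y)) ∧
          ¬ ∃ y : APoint D.H, IsOfFinAddOrder (D.Z n - (4 : ℤ) • y)))) ∧
    (IsDeltaOne l →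
      ((∀ L : ℤ, IsScriptL n L → (2 : ℤ) ∣ L ∧ ¬ (4 : ℤ) ∣ L) ↔
        ((∃ y : APoint D.H, IsOfFinAddOrder (D.Z n - (2 : ℤ) • y)) ∧
          ¬ ∃ y : APoint D.H, IsOfFinAddOrder (D.Z n - αq - (4 : ℤ) • y)))) := by
  have hL := isScriptL_scriptL_left hl hq hn D hPr.1
  have hδ := RankZeroDigit.not_four_dvd_scriptL_iff_isDeltaOne_of_facts hmod hCM0 h3 hL4 hl hl8 h0 hL
  obtain ⟨-, -, hiff⟩ := RankZeroDigit.prime_one_mod_eight_digit_of_facts hmod hCM0 hl hl8 h0 hL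
  obtain ⟨hne, heq⟩ := levelTwo_iff_genusPeriod_depth_dichotomy_of_facts hGZK hmod hCM0 hl hq hl8 hq8 hn hr h0 D hPr hC hρ h hs hX
    hgen hLq hu h35q
  constructor
  · intro hδ0
    exact hne (hiff.mp (by by_contra h4; exact hδ0 (hδ.mp h4)))
  · intro hδ1
    exact heq (by by_contra hS₄; exact (hδ.mpr hδ1) (hiff.mpr hS₄))

end Wang

end Summit.BirchSwinnertonDyer.PrintCf2.RankZeroDigitDepthTwo

end
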